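import Summits.Ventures.HSemireg.WedgeHankelRecurrenceGaussChebyshevCommonNodes

/-!
# Venture HSemireg — **DISCRIMINANTS OF THE MONIC NORMALISATIONS: `disc(S_{n+1}) = 2^{n+1} (n+2)^{n−1}` AND `disc(C_{n+1}) = 2^n (n+1)^{n+1}`** (typed over `ℤ` as `(n+2)² disc(S_{n+1}) =
# 2^{n+1}(n+2)^{n+1}`, `disc(S_{n+2}) = 2^{n+2}(n+3)^n`, `4 disc(C_{n+1}) = 2^{n+2}(n+1)^{n+1}`, `disc(C_{n+1}) = 2^n (n+1)^{n+1}`; Mathlib's `S_n(x) = U_n(x∕2)`, `C_n(x) = 2T_n(x∕2)` and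
# `Polynomial.discr`) — SCHUR's method on `[−2, 2]`: the differential relations **`(4 − X²) S_n′ = 2(n+1) S_{n−1} − n X S_n`**, **`(4 − X²) C_n′ = n (2 C_{n−1} − X C_n)`** (all `n ∈ ℤ`, any
# commutative ring), `Res_{(m,2)}(f, 4 − X²) = (−1)^m f(2) f(−2)`, the Schur–Stieltjes lemma N404 and the consecutive resultants N468 (`S`) ∕ N469 (`C`, value `±2`)

HONEST FRAMING. Part of the Lean index of the computation cell `pub-hsemireg` (seat p10 gen 48, Sunday typer «UNIFORM-IN-n»).  Polynomial ∕ resultant ∕ discriminant algebra only; no variety, no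
cohomology theory, no sheaf, no Ext group and no semiregularity map is constructed here; nothing here says that HC / HC_CM / HC_AV holds; no Literature fact (unproved `Prop`) is declared or used.
Custodian versions as in `WedgeHankelSiegelIdeal` (1/3).
SOURCES (cited).  I. Schur, J. Reine Angew. Math. 165 (1931) 52–58, §2; G. Szegő, *Orthogonal Polynomials*, (6.71.5)–(6.71.7); K. Dilcher, K. B. Stolarsky, Trans. Amer. Math. Soc. 357 (2005) 965–981,
(1.3)–(1.4) and §4 (discriminants of `T_n`, `U_n` and of the Dickson normalisations).  Consistency check: `disc(S_2) = disc(x² − 1) = 4 = 2²·3⁰`, `disc(C_2) = disc(x² − 2) = 8 = 2¹·2²`.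
PROOF TYPED HERE.  N404 `resultant_mul_discr_eq`; N407 pattern (`resultant_one_sub_X_sq`); N465 `chebyshevS_natDegree_monic`; N468 `chebyshevS_resultant_succ`; N469 `chebyshevC_resultant_closed_int`;
`Literature…ChebyshevChains.monic_chebyshevC_and_natDegree`; Mathlib `S_add_two ∕ S_sub_one ∕ S_eval_two ∕ S_eval_neg_two`, `C_add_two ∕ C_sub_one ∕ C_eval_two ∕ C_eval_neg_two`, `derivative_mul`,
`resultant_mul_right`, `resultant_X_sub_C_right`, `resultant_X_add_C_right`, `resultant_C_mul_right`, `Int.coe_negOnePow_natCast`.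
DEDUP DISCLOSURE (`rg -n 'four_sub_X_sq|chebyshevS_discr|chebyshevC_discr|resultant_four_sub_X_sq' Summits Literature HarnessLib`, 2026-09-04): N407 `chebyshevT_discr ∕ chebyshevU_discr` (the `T`, `U`
normalisations), `resultant_one_sub_X_sq`; 0 hits for the 9 names below.

WHAT IS IN THE TREE.  N404, N407, N465, N468, N469.
THIS FILE (namespace `Summit.Ventures.HSemireg.Wedge.HankelOuter` continued; CHAINED on N470; 0 definitions):
* §1236 **`four_sub_X_sq_mul_derivative_S`**, **`four_sub_X_sq_mul_derivative_C`** (differential relations), `resultant_four_sub_X_sq`, `chebyshevS_resultant_four_sub_X_sq`,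
  `chebyshevC_resultant_four_sub_X_sq`, **`chebyshevS_discr`**, **`chebyshevS_discr'`**, **`chebyshevC_discr`**, **`chebyshevC_discr'`**.
CAVEATS.  Over `ℤ`; `(n+2)^{n−1}` is stated in multiplied-out ∕ shifted forms to avoid negative exponents.  Nothing Ext-side.  New names only.
-/

open Module Polynomial
open scoped Matrix Polynomial

namespace Summit.Ventures.HSemireg.Wedge.HankelOuter

/-! ## §1236. `disc(S_n)` and `disc(C_n)` -/

/-- **`(4 − X²) S_n′ = 2(n+1) S_{n−1} − n X S_n`** (all `n ∈ ℤ`, any commutative ring). [Szegő (4.7.x) rescaled; this file, §1236] -/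
theorem four_sub_X_sq_mul_derivative_S (R : Type*) [CommRing R] (n : ℤ) :
    (4 - Polynomial.X ^ 2) * derivative (Polynomial.Chebyshev.S R n) =
      2 * ((n : R[X]) + 1) * Polynomial.Chebyshev.S R (n - 1) - (n : R[X]) * Polynomial.X * Polynomial.Chebyshev.S R n := by
  induction n using Polynomial.Chebyshev.induct with
  | zero => simp only [Polynomial.Chebyshev.S_zero, derivative_one, mul_zero, Int.cast_zero, zero_add, zero_sub, Polynomial.Chebyshev.S_neg_one, zero_mul, sub_zero]
  | one =>
    rw [Polynomial.Chebyshev.S_one, derivative_X, mul_one, show (1 : ℤ) - 1 = 0 by norm_num, Polynomial.Chebyshev.S_zero, Int.cast_one]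
    ring
  | add_two n ih1 ih2 =>
    have hrec := Polynomial.Chebyshev.S_add_two R (n : ℤ)
    have hrec' := Polynomial.Chebyshev.S_add_one R (n : ℤ)
    have e0 := congrArg Polynomial.derivative hrec
    simp only [derivative_sub, derivative_mul, derivative_X, one_mul] at e0
    linear_combination (norm := (push_cast; ring_nf)) (4 - Polynomial.X ^ 2 : R[X]) * e0 + (Polynomial.X : R[X]) * ih1 - ih2 +
      ((n : R[X]) + 2) * Polynomial.X * hrec - 2 * ((n : R[X]) + 1) * hrec'
  | neg_add_one n ih1 ih2 =>
    have hrec1 := Polynomial.Chebyshev.S_sub_one R (-(n : ℤ))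
    have hrec2 := Polynomial.Chebyshev.S_sub_one R (-(n : ℤ) - 1)
    have e0 := congrArg Polynomial.derivative hrec1
    simp only [derivative_sub, derivative_mul, derivative_X, one_mul] at e0
    linear_combination (norm := (push_cast; ring_nf)) (4 - Polynomial.X ^ 2 : R[X]) * e0 + (Polynomial.X : R[X]) * ih1 - ih2 +
      ((-(n : R[X])) + 1) * Polynomial.X * hrec1 + 2 * (n : R[X]) * hrec2

/-- **`(4 − X²) C_n′ = n (2 C_{n−1} − X C_n)`** (all `n ∈ ℤ`, any commutative ring). [Szegő (4.7.x) rescaled; this file, §1236] -/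
theorem four_sub_X_sq_mul_derivative_C (R : Type*) [CommRing R] (n : ℤ) :
    (4 - Polynomial.X ^ 2) * derivative (Polynomial.Chebyshev.C R n) =
      (n : R[X]) * (2 * Polynomial.Chebyshev.C R (n - 1) - Polynomial.X * Polynomial.Chebyshev.C R n) := by
  induction n using Polynomial.Chebyshev.induct with
  | zero => simp only [Polynomial.Chebyshev.C_zero, Int.cast_zero, zero_mul, show (2 : R[X]) = Polynomial.C 2 from (Polynomial.C_ofNat 2).symm, derivative_C, mul_zero]
  | one =>
    rw [Polynomial.Chebyshev.C_one, derivative_X, mul_one, show (1 : ℤ) - 1 = 0 by norm_num, Polynomial.Chebyshev.C_zero, Int.cast_one]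
    ring
  | add_two n ih1 ih2 =>
    have hrec := Polynomial.Chebyshev.C_add_two R (n : ℤ)
    have hrec' := Polynomial.Chebyshev.C_add_one R (n : ℤ)
    have e0 := congrArg Polynomial.derivative hrec
    simp only [derivative_sub, derivative_mul, derivative_X, one_mul] at e0
    linear_combination (norm := (push_cast; ring_nf)) (4 - Polynomial.X ^ 2 : R[X]) * e0 + (Polynomial.X : R[X]) * ih1 - ih2 +
      ((n : R[X]) + 2) * Polynomial.X * hrec - 2 * (n : R[X]) * hrec'
  | neg_add_one n ih1 ih2 =>
    have hrec1 := Polynomial.Chebyshev.C_sub_one R (-(n : ℤ))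
    have hrec2 := Polynomial.Chebyshev.C_sub_one R (-(n : ℤ) - 1)
    have e0 := congrArg Polynomial.derivative hrec1
    simp only [derivative_sub, derivative_mul, derivative_X, one_mul] at e0
    linear_combination (norm := (push_cast; ring_nf)) (4 - Polynomial.X ^ 2 : R[X]) * e0 + (Polynomial.X : R[X]) * ih1 - ih2 +
      ((-(n : R[X])) + 1) * Polynomial.X * hrec1 + 2 * ((n : R[X]) + 1) * hrec2

/-- `Res_{(m,2)}(f, 4 − X²) = (−1)^m · f(2) · f(−2)` (`deg f ≤ m`, nontrivial commutative ring; `4 − X² = −(X − 2)(X + 2)`). [as N407 `resultant_one_sub_X_sq`; this file, §1236] -/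
theorem resultant_four_sub_X_sq {R : Type*} [CommRing R] [Nontrivial R] {f : R[X]} {m : ℕ} (hf : f.natDegree ≤ m) :
    f.resultant (4 - Polynomial.X ^ 2) m 2 = (-1) ^ m * (f.eval 2 * f.eval (-2)) := by
  have hm := resultant_mul_right f (Polynomial.X - C 2) (Polynomial.X + C 2) m hf
  rw [natDegree_X_sub_C, natDegree_X_add_C, show (1 : ℕ) + 1 = 2 from rfl, resultant_X_sub_C_right _ _ _ hf, resultant_X_add_C_right _ _ _ hf] at hm
  rw [show (4 - Polynomial.X ^ 2 : R[X]) = C (-1 : R) * ((Polynomial.X - C 2) * (Polynomial.X + C 2)) by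
      simp only [map_neg, map_one, show (C 2 : R[X]) = 2 from Polynomial.C_ofNat 2]; ring, resultant_C_mul_right, hm]
  have hsq : ((-1 : R) ^ m) * ((-1 : R) ^ m) = 1 := by rw [← pow_add, ← two_mul, pow_mul, neg_one_sq, one_pow]
  linear_combination ((-1 : R) ^ m * f.eval 2 * f.eval (-2)) * hsq

/-- `Res_{(n+1,2)}(S_{n+1}, 4 − X²) = (n+2)²` over `ℤ` (`S_{n+1}(2) = n+2`, `S_{n+1}(−2) = (−1)^{n+1}(n+2)`). [this file, §1236] -/
theorem chebyshevS_resultant_four_sub_X_sq (n : ℕ) :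
    (Polynomial.Chebyshev.S ℤ ((n : ℤ) + 1)).resultant (4 - Polynomial.X ^ 2) (n + 1) 2 = ((n : ℤ) + 2) ^ 2 := by
  have hd := (chebyshevS_natDegree_monic (R := ℤ) (n + 1)).1
  rw [Nat.cast_succ] at hd
  have hneg : ((((n : ℤ) + 1).negOnePow : ℤˣ) : ℤ) = (-1) ^ (n + 1) := by
    rw [show ((n : ℤ) + 1) = ((n + 1 : ℕ) : ℤ) by push_cast; ring]; exact Int.coe_negOnePow_natCast (n + 1)
  rw [resultant_four_sub_X_sq hd.le, Polynomial.Chebyshev.S_eval_two, Polynomial.Chebyshev.S_eval_neg_two, hneg]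
  push_cast
  have hsq : ((-1 : ℤ) ^ (n + 1)) * ((-1 : ℤ) ^ (n + 1)) = 1 := by rw [← pow_add, ← two_mul, pow_mul, neg_one_sq, one_pow]
  linear_combination (((n : ℤ) + 1 + 1) ^ 2) * hsq

/-- `Res_{(n+1,2)}(C_{n+1}, 4 − X²) = 4` over `ℤ` (`C_{n+1}(±2) = ±2`). [this file, §1236] -/
theorem chebyshevC_resultant_four_sub_X_sq (n : ℕ) :
    (Polynomial.Chebyshev.C ℤ ((n : ℤ) + 1)).resultant (4 - Polynomial.X ^ 2) (n + 1) 2 = 4 := by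
  have hd := (Literature.Algebra.Polynomial.ChebyshevChains.monic_chebyshevC_and_natDegree (R := ℤ) n).2
  rw [Nat.cast_succ] at hd
  have hneg : ((((n : ℤ) + 1).negOnePow : ℤˣ) : ℤ) = (-1) ^ (n + 1) := by
    rw [show ((n : ℤ) + 1) = ((n + 1 : ℕ) : ℤ) by push_cast; ring]; exact Int.coe_negOnePow_natCast (n + 1)
  rw [resultant_four_sub_X_sq hd.le, Polynomial.Chebyshev.C_eval_two, Polynomial.Chebyshev.C_eval_neg_two, hneg]
  push_cast
  have hsq : ((-1 : ℤ) ^ (n + 1)) * ((-1 : ℤ) ^ (n + 1)) = 1 := by rw [← pow_add, ← two_mul, pow_mul, neg_one_sq, one_pow]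
  linear_combination 4 * hsq

/-- **`(n+2)² · disc(S_{n+1}) = 2^{n+1} (n+2)^{n+1}`** over `ℤ` (i.e. `disc(S_{n+1}) = 2^{n+1}(n+2)^{n−1}` for `n ≥ 1`). [Dilcher–Stolarsky (1.4), monic form; this file, §1236] -/
theorem chebyshevS_discr (n : ℕ) : ((n : ℤ) + 2) ^ 2 * (Polynomial.Chebyshev.S ℤ ((n : ℤ) + 1)).discr = 2 ^ (n + 1) * ((n : ℤ) + 2) ^ (n + 1) := by
  obtain ⟨hd, hmonic⟩ := chebyshevS_natDegree_monic (R := ℤ) (n + 1)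
  rw [Nat.cast_succ] at hd hmonic
  obtain ⟨hdn, -⟩ := chebyshevS_natDegree_monic (R := ℤ) n
  have hlc : (Polynomial.Chebyshev.S ℤ ((n : ℤ) + 1)).leadingCoeff = 1 := hmonic
  have hlow : (4 - Polynomial.X ^ 2) * derivative (Polynomial.Chebyshev.S ℤ ((n : ℤ) + 1)) =
      (C (-((n : ℤ) + 1)) * Polynomial.X) * Polynomial.Chebyshev.S ℤ ((n : ℤ) + 1) + C (2 * ((n : ℤ) + 2)) * Polynomial.Chebyshev.S ℤ (n : ℤ) := by
    rw [four_sub_X_sq_mul_derivative_S ℤ ((n : ℤ) + 1), add_sub_cancel_right]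
    simp only [map_add, map_neg, map_mul, map_natCast, map_one, map_ofNat]
    push_cast
    ring
  have hπ : (4 - Polynomial.X ^ 2 : ℤ[X]).natDegree ≤ 2 :=
    (natDegree_sub_le _ _).trans (max_le (by rw [show (4 : ℤ[X]) = C 4 from (Polynomial.C_ofNat 4).symm, natDegree_C]; omega) (natDegree_pow_le_of_le 2 natDegree_X_le))
  have hA : (C (-((n : ℤ) + 1)) * Polynomial.X).natDegree + 1 ≤ 2 := by have := (natDegree_C_mul_le (-((n : ℤ) + 1)) Polynomial.X).trans natDegree_X_le; omega
  have hsucc := chebyshevS_resultant_succ (R := ℤ) n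
  rw [Nat.cast_succ] at hsucc
  have e := resultant_mul_discr_eq hd hπ hA hdn.le hlow
  rw [hlc, chebyshevS_resultant_four_sub_X_sq, hsucc, show (n + 1) * n / 2 = n * (n + 1) / 2 by rw [mul_comm], mul_pow] at e
  have hne : (-1 : ℤ) ^ (n * (n + 1) / 2) ≠ 0 := pow_ne_zero _ (by norm_num)
  apply mul_left_cancel₀ hne
  linear_combination e

/-- **`disc(S_{n+2}) = 2^{n+2} (n+3)^n`** over `ℤ`. [Dilcher–Stolarsky (1.4), monic form; this file, §1236] -/
theorem chebyshevS_discr' (n : ℕ) : (Polynomial.Chebyshev.S ℤ ((n : ℤ) + 2)).discr = 2 ^ (n + 2) * ((n : ℤ) + 3) ^ n := by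
  have h := chebyshevS_discr (n + 1)
  push_cast at h
  rw [show (n : ℤ) + 1 + 1 = (n : ℤ) + 2 by ring, show (n : ℤ) + 1 + 2 = (n : ℤ) + 3 by ring] at h
  have hne : ((n : ℤ) + 3) ^ 2 ≠ 0 := pow_ne_zero _ (by positivity)
  apply mul_left_cancel₀ hne
  rw [h]
  ring

/-- **`4 · disc(C_{n+1}) = 2^{n+2} (n+1)^{n+1}`** over `ℤ`. [Dilcher–Stolarsky §4 (Dickson normalisation); this file, §1236] -/
theorem chebyshevC_discr (n : ℕ) : 4 * (Polynomial.Chebyshev.C ℤ ((n : ℤ) + 1)).discr = 2 ^ (n + 2) * ((n : ℤ) + 1) ^ (n + 1) := by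
  obtain ⟨hmonic, hd⟩ := Literature.Algebra.Polynomial.ChebyshevChains.monic_chebyshevC_and_natDegree (R := ℤ) n
  rw [Nat.cast_succ] at hmonic hd
  have hdn : (Polynomial.Chebyshev.C ℤ (n : ℤ)).natDegree ≤ n := chebyshevC_natDegree_le n
  have hlc : (Polynomial.Chebyshev.C ℤ ((n : ℤ) + 1)).leadingCoeff = 1 := hmonic
  have hlow : (4 - Polynomial.X ^ 2) * derivative (Polynomial.Chebyshev.C ℤ ((n : ℤ) + 1)) =
      (C (-((n : ℤ) + 1)) * Polynomial.X) * Polynomial.Chebyshev.C ℤ ((n : ℤ) + 1) + C (2 * ((n : ℤ) + 1)) * Polynomial.Chebyshev.C ℤ (n : ℤ) := by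
    rw [four_sub_X_sq_mul_derivative_C ℤ ((n : ℤ) + 1), add_sub_cancel_right]
    simp only [map_add, map_neg, map_mul, map_natCast, map_one, map_ofNat]
    push_cast
    ring
  have hπ : (4 - Polynomial.X ^ 2 : ℤ[X]).natDegree ≤ 2 :=
    (natDegree_sub_le _ _).trans (max_le (by rw [show (4 : ℤ[X]) = C 4 from (Polynomial.C_ofNat 4).symm, natDegree_C]; omega) (natDegree_pow_le_of_le 2 natDegree_X_le))
  have hA : (C (-((n : ℤ) + 1)) * Polynomial.X).natDegree + 1 ≤ 2 := by have := (natDegree_C_mul_le (-((n : ℤ) + 1)) Polynomial.X).trans natDegree_X_le; omega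
  have hcons : (Polynomial.Chebyshev.C ℤ ((n : ℤ) + 1)).resultant (Polynomial.Chebyshev.C ℤ (n : ℤ)) (n + 1) n = (-1) ^ (n * (n + 1) / 2) * 2 := by
    have h := chebyshevC_resultant_closed_int (n + 1) n
    have hg : Nat.gcd (n + 1) n = 1 := Nat.Coprime.gcd_eq_one (Nat.coprime_self_add_left.2 (Nat.coprime_one_left n))
    rw [Nat.cast_succ, hg, Nat.div_one, Nat.div_one, if_neg (fun h' => (Nat.not_even_iff_odd.2 h'.1) h'.2.add_one), pow_one, mul_comm (n + 1) n] at h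
    exact h
  have e := resultant_mul_discr_eq hd hπ hA hdn hlow
  rw [hlc, chebyshevC_resultant_four_sub_X_sq, hcons, show (n + 1) * n / 2 = n * (n + 1) / 2 by rw [mul_comm], mul_pow] at e
  have hne : (-1 : ℤ) ^ (n * (n + 1) / 2) ≠ 0 := pow_ne_zero _ (by norm_num)
  apply mul_left_cancel₀ hne
  linear_combination e

/-- **`disc(C_{n+1}) = 2^n (n+1)^{n+1}`** over `ℤ`. [Dilcher–Stolarsky §4; this file, §1236] -/
theorem chebyshevC_discr' (n : ℕ) : (Polynomial.Chebyshev.C ℤ ((n : ℤ) + 1)).discr = 2 ^ n * ((n : ℤ) + 1) ^ (n + 1) := by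
  have h := chebyshevC_discr n
  have hne : (4 : ℤ) ≠ 0 := by norm_num
  apply mul_left_cancel₀ hne
  rw [h, pow_add]
  ring

end Summit.Ventures.HSemireg.Wedge.HankelOuter
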